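import Summits.Ventures.LatticeQCDFlow.Exactness.NCMCGeneralSpaceGammaMethodWindow

/-!
# Scorer A's windowed variance statistic `Γ̂^u_N(0) · 2 τ̂^u_{N,K}` as a function of a real series: its
# POLARISATION into a cross statistic of two series, measurability, and DETERMINISTIC PERTURBATION BOUNDS

HONEST FRAMING: exact (Metropolis-corrected) sampling algorithms for lattice gauge theory;
figures of merit are autocorrelation/cost numbers at stated couplings and volumes; no
continuum-physics claim.

Venture `LatticeQCDFlow` (cell pub-lqcd), sub-topic `Scoring`; FANOUT row 16 (`su2-base`), GEN-10.
NEW WORK of the cell, not a published result; two definitions, both plain functions of real series: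
`gammaStat u N K = Γ̂^u_N(0) · 2 τ̂^u_{N,K}` — scorer A's windowed Γ-method variance statistic of ONE
series (row 11's verbatim typing `gammaHat` / `rhoHat` / `tauIntWindow` of `Scoring/SampleACFSumZero`;
the object of row 13's `NCMCGeneralSpaceGammaMethodConsistency`) — and `gammaCross u v N K`, its
POLARISATION `½ (V(u+v) − V(u) − V(v))`, a windowed estimator of the long-run CROSS covariance of two
series; nothing is cited as a fact.  Pure real-series algebra, no probability: measurability in a jointly
measurable series, the windowed-sum form `Γ̂(0) + 2 Σ_{k<K} Γ̂(k+1)` (row 13's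
`gammaWindow_eq_gammaHat_mul_tauIntWindow`), and the perturbation bounds that let GEN-10's chain files
(`Scoring/ChainTauIntVarianceEstimator`, `Scoring/ChainTauIntEmpiricalVariance`) replace true-mean
centring by sample-mean centring inside the lag products: if two series differ termwise by at most `η`
and are bounded by `M`, `M'`, then `|Γ̂^u_N(t) − Γ̂^v_N(t)| ≤ 4η (M + M')`,
`|gammaStat u − gammaStat v| ≤ (2K+1) · 4η (M + M')`, `|gammaCross u v − gammaCross u' v'| ≤ (2K+1) · 12η (M + M')`.

## Content

* `gammaStat` [ours], `gammaCross` [ours]; `measurable_sampleMean_series`, `measurable_gammaHat_series`,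
  `measurable_gammaStat`, `measurable_gammaCross`;
* `abs_sampleMean_le`, `abs_sampleMean_sub_le`, `abs_dev_le`, `abs_dev_sub_le`;
* **`abs_gammaHat_sub_le`**, `gammaStat_eq_sum`, **`abs_gammaStat_sub_le`**, **`abs_gammaCross_sub_le`**.

NOT CLAIMED: anything probabilistic (see the chain files); sharper constants.
-/

noncomputable section

open MeasureTheory Finset
open Summit.Ventures.LatticeQCDFlow.Exactness Summit.Ventures.LatticeQCDFlow.Exactness.GeneralNCMC

namespace Summit.Ventures.LatticeQCDFlow.Scoring

/-! ## Scorer A's windowed variance statistic of a series, and its polarisation -/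

section Series

/-- Scorer A's windowed Γ-method variance statistic of a real series `u` at truncation `K`:
`Γ̂^u_N(0) · 2 τ̂^u_{N,K}` (`= Γ̂^u_N(0) + 2 Σ_{k=1}^{K} Γ̂^u_N(k)` on every path, row 13's
`gammaWindow_eq_gammaHat_mul_tauIntWindow`). [ours] -/
def gammaStat (u : ℕ → ℝ) (N K : ℕ) : ℝ :=
  gammaHat u N 0 * (2 * tauIntWindow (rhoHat u N) K)

/-- The POLARISED cross statistic of two real series: `½ (V(u + v) − V(u) − V(v))`, `V = gammaStat`
— a windowed estimator of the long-run CROSS covariance of `u` and `v`. [ours] -/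
def gammaCross (u v : ℕ → ℝ) (N K : ℕ) : ℝ :=
  (gammaStat (fun i => u i + v i) N K - gammaStat u N K - gammaStat v N K) / 2

variable {Ω : Type*} [MeasurableSpace Ω]

/-- The sample mean of a jointly measurable series is measurable. -/
theorem measurable_sampleMean_series {u : ℕ → Ω → ℝ} (hu : ∀ i, Measurable (u i)) (N : ℕ) :
    Measurable fun ω => sampleMean (fun i => u i ω) N := by
  unfold sampleMean
  exact (Finset.measurable_sum _ fun i _ => hu i).div_const _

/-- Scorer A's `Γ̂(t)` of a jointly measurable series is measurable. -/
theorem measurable_gammaHat_series {u : ℕ → Ω → ℝ} (hu : ∀ i, Measurable (u i)) (N t : ℕ) :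
    Measurable fun ω => gammaHat (fun i => u i ω) N t := by
  have hmean := measurable_sampleMean_series hu N
  unfold gammaHat acovSum lagSum dev
  exact (Finset.measurable_sum _ fun i _ =>
    ((hu i).sub hmean).mul ((hu (i + t)).sub hmean)).div_const _

/-- `gammaStat` of a jointly measurable series is measurable. -/
theorem measurable_gammaStat {u : ℕ → Ω → ℝ} (hu : ∀ i, Measurable (u i)) (N K : ℕ) :
    Measurable fun ω => gammaStat (fun i => u i ω) N K := by
  unfold gammaStat tauIntWindow rhoHat
  exact (measurable_gammaHat_series hu N 0).mul (measurable_const.mul (measurable_const.add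
    (Finset.measurable_sum _ fun k _ =>
      (measurable_gammaHat_series hu N (k + 1)).div (measurable_gammaHat_series hu N 0))))

/-- `gammaCross` of two jointly measurable series is measurable. -/
theorem measurable_gammaCross {u v : ℕ → Ω → ℝ} (hu : ∀ i, Measurable (u i))
    (hv : ∀ i, Measurable (v i)) (N K : ℕ) :
    Measurable fun ω => gammaCross (fun i => u i ω) (fun i => v i ω) N K := by
  unfold gammaCross
  exact (((measurable_gammaStat (u := fun i ω => u i ω + v i ω) (fun i => (hu i).add (hv i)) N K).sub
    (measurable_gammaStat hu N K)).sub (measurable_gammaStat hv N K)).div_const _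

end Series

/-! ## Deterministic perturbation bounds for scorer A's statistics -/

section Perturbation

/-- `|u_i| ≤ M` for all `i` ⇒ `|ū_N| ≤ M`. -/
theorem abs_sampleMean_le {u : ℕ → ℝ} {M : ℝ} (hM : ∀ i, |u i| ≤ M) (N : ℕ) :
    |sampleMean u N| ≤ M := by
  have hM0 : 0 ≤ M := (abs_nonneg _).trans (hM 0)
  unfold sampleMean
  rcases Nat.eq_zero_or_pos N with hN | hN
  · subst hN; simpa using hM0
  · have hNR : (0 : ℝ) < N := Nat.cast_pos.2 hN
    rw [abs_div, Nat.abs_cast, div_le_iff₀ hNR]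
    calc |∑ i ∈ range N, u i| ≤ ∑ i ∈ range N, |u i| := abs_sum_le_sum_abs _ _
      _ ≤ ∑ _i ∈ range N, M := sum_le_sum fun i _ => hM i
      _ = M * N := by rw [sum_const, card_range, nsmul_eq_mul, mul_comm]

/-- `|u_i − v_i| ≤ η` for all `i` ⇒ `|ū_N − v̄_N| ≤ η`. -/
theorem abs_sampleMean_sub_le {u v : ℕ → ℝ} {η : ℝ} (h : ∀ i, |u i - v i| ≤ η) (N : ℕ) :
    |sampleMean u N - sampleMean v N| ≤ η := by
  have e : sampleMean u N - sampleMean v N = sampleMean (fun i => u i - v i) N := by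
    unfold sampleMean
    rw [← sub_div, ← sum_sub_distrib]
  rw [e]
  exact abs_sampleMean_le h N

/-- `|u_i| ≤ M` for all `i` ⇒ `|u_i − ū_N| ≤ 2M`. -/
theorem abs_dev_le {u : ℕ → ℝ} {M : ℝ} (hM : ∀ i, |u i| ≤ M) (N i : ℕ) : |dev u N i| ≤ 2 * M := by
  unfold dev
  calc |u i - sampleMean u N| ≤ |u i| + |sampleMean u N| := abs_sub _ _
    _ ≤ M + M := add_le_add (hM i) (abs_sampleMean_le hM N)
    _ = 2 * M := by ring

/-- `|u_i − v_i| ≤ η` for all `i` ⇒ the deviations from the sample means differ by at most `2η`. -/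
theorem abs_dev_sub_le {u v : ℕ → ℝ} {η : ℝ} (h : ∀ i, |u i - v i| ≤ η) (N i : ℕ) :
    |dev u N i - dev v N i| ≤ 2 * η := by
  unfold dev
  calc |u i - sampleMean u N - (v i - sampleMean v N)|
      = |(u i - v i) - (sampleMean u N - sampleMean v N)| := by ring_nf
    _ ≤ |u i - v i| + |sampleMean u N - sampleMean v N| := abs_sub _ _
    _ ≤ η + η := add_le_add (h i) (abs_sampleMean_sub_le h N)
    _ = 2 * η := by ring

/-- **PERTURBATION BOUND FOR SCORER A's `Γ̂(t)`**: if `|u_i − v_i| ≤ η`, `|u_i| ≤ M`, `|v_i| ≤ M'` for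
all `i`, then `|Γ̂^u_N(t) − Γ̂^v_N(t)| ≤ 4η (M + M')` for every `N, t`. -/
theorem abs_gammaHat_sub_le {u v : ℕ → ℝ} {η M M' : ℝ} (h : ∀ i, |u i - v i| ≤ η)
    (hM : ∀ i, |u i| ≤ M) (hM' : ∀ i, |v i| ≤ M') (N t : ℕ) :
    |gammaHat u N t - gammaHat v N t| ≤ 4 * η * (M + M') := by
  have hη0 : 0 ≤ η := (abs_nonneg _).trans (h 0)
  have hM0 : 0 ≤ M := (abs_nonneg _).trans (hM 0)
  have hM0' : 0 ≤ M' := (abs_nonneg _).trans (hM' 0)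
  have hbnd : 0 ≤ 4 * η * (M + M') := by positivity
  have hterm : ∀ i j, |dev u N i * dev u N j - dev v N i * dev v N j| ≤ 4 * η * (M + M') := by
    intro i j
    have e : dev u N i * dev u N j - dev v N i * dev v N j
        = (dev u N i - dev v N i) * dev u N j + dev v N i * (dev u N j - dev v N j) := by ring
    rw [e]
    calc |(dev u N i - dev v N i) * dev u N j + dev v N i * (dev u N j - dev v N j)|
        ≤ |dev u N i - dev v N i| * |dev u N j| + |dev v N i| * |dev u N j - dev v N j| := by
          refine (abs_add_le _ _).trans ?_
          rw [abs_mul, abs_mul]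
      _ ≤ 2 * η * (2 * M) + 2 * M' * (2 * η) :=
          add_le_add (mul_le_mul (abs_dev_sub_le h N i) (abs_dev_le hM N j) (abs_nonneg _)
              (by positivity))
            (mul_le_mul (abs_dev_le hM' N i) (abs_dev_sub_le h N j) (abs_nonneg _) (by positivity))
      _ = 4 * η * (M + M') := by ring
  unfold gammaHat acovSum lagSum
  rw [← sub_div, ← sum_sub_distrib]
  rcases Nat.eq_zero_or_pos (N - t) with hNt | hNt
  · rw [hNt]; simpa using hbnd
  · have hR : (0 : ℝ) < ((N - t : ℕ) : ℝ) := Nat.cast_pos.2 hNt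
    rw [abs_div, Nat.abs_cast, div_le_iff₀ hR]
    calc |∑ i ∈ range (N - t), (dev u N i * dev u N (i + t) - dev v N i * dev v N (i + t))|
        ≤ ∑ i ∈ range (N - t), |dev u N i * dev u N (i + t) - dev v N i * dev v N (i + t)| :=
          abs_sum_le_sum_abs _ _
      _ ≤ ∑ _i ∈ range (N - t), 4 * η * (M + M') := sum_le_sum fun i _ => hterm i (i + t)
      _ = 4 * η * (M + M') * ((N - t : ℕ) : ℝ) := by
          rw [sum_const, card_range, nsmul_eq_mul, mul_comm]

/-- `gammaStat` is row 13's windowed sum `Γ̂(0) + 2 Σ_{k<K} Γ̂(k+1)` on every path. -/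
theorem gammaStat_eq_sum (u : ℕ → ℝ) (N K : ℕ) :
    gammaStat u N K = gammaHat u N 0 + 2 * ∑ k ∈ range K, gammaHat u N (k + 1) := by
  unfold gammaStat
  exact (gammaWindow_eq_gammaHat_mul_tauIntWindow u N K).symm

/-- **PERTURBATION BOUND FOR `gammaStat`**: `|gammaStat u N K − gammaStat v N K| ≤ (2K+1) · 4η (M + M')`. -/
theorem abs_gammaStat_sub_le {u v : ℕ → ℝ} {η M M' : ℝ} (h : ∀ i, |u i - v i| ≤ η)
    (hM : ∀ i, |u i| ≤ M) (hM' : ∀ i, |v i| ≤ M') (N K : ℕ) :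
    |gammaStat u N K - gammaStat v N K| ≤ (2 * K + 1) * (4 * η * (M + M')) := by
  rw [gammaStat_eq_sum, gammaStat_eq_sum]
  have e : gammaHat u N 0 + 2 * ∑ k ∈ range K, gammaHat u N (k + 1)
      - (gammaHat v N 0 + 2 * ∑ k ∈ range K, gammaHat v N (k + 1))
      = (gammaHat u N 0 - gammaHat v N 0)
        + 2 * ∑ k ∈ range K, (gammaHat u N (k + 1) - gammaHat v N (k + 1)) := by
    rw [sum_sub_distrib]; ring
  rw [e]
  calc |gammaHat u N 0 - gammaHat v N 0
        + 2 * ∑ k ∈ range K, (gammaHat u N (k + 1) - gammaHat v N (k + 1))|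
      ≤ |gammaHat u N 0 - gammaHat v N 0|
        + 2 * ∑ k ∈ range K, |gammaHat u N (k + 1) - gammaHat v N (k + 1)| := by
          refine (abs_add_le _ _).trans (add_le_add le_rfl ?_)
          rw [abs_mul, abs_two]
          exact mul_le_mul_of_nonneg_left (abs_sum_le_sum_abs _ _) (by norm_num)
    _ ≤ 4 * η * (M + M') + 2 * ∑ _k ∈ range K, 4 * η * (M + M') :=
          add_le_add (abs_gammaHat_sub_le h hM hM' N 0) (mul_le_mul_of_nonneg_left
            (sum_le_sum fun k _ => abs_gammaHat_sub_le h hM hM' N (k + 1)) (by norm_num))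
    _ = (2 * K + 1) * (4 * η * (M + M')) := by
          rw [sum_const, card_range, nsmul_eq_mul]; ring

/-- **PERTURBATION BOUND FOR `gammaCross`**: if `|u − u'| ≤ η`, `|v − v'| ≤ η` termwise, `|u|, |v| ≤ M`,
`|u'|, |v'| ≤ M'`, then `|gammaCross u v N K − gammaCross u' v' N K| ≤ (2K+1) · 12η (M + M')`. -/
theorem abs_gammaCross_sub_le {u v u' v' : ℕ → ℝ} {η M M' : ℝ} (hu : ∀ i, |u i - u' i| ≤ η)
    (hv : ∀ i, |v i - v' i| ≤ η) (hMu : ∀ i, |u i| ≤ M) (hMv : ∀ i, |v i| ≤ M)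
    (hMu' : ∀ i, |u' i| ≤ M') (hMv' : ∀ i, |v' i| ≤ M') (N K : ℕ) :
    |gammaCross u v N K - gammaCross u' v' N K| ≤ (2 * K + 1) * (12 * η * (M + M')) := by
  have hsum : ∀ i, |(u i + v i) - (u' i + v' i)| ≤ 2 * η := fun i => by
    calc |(u i + v i) - (u' i + v' i)| = |(u i - u' i) + (v i - v' i)| := by ring_nf
      _ ≤ |u i - u' i| + |v i - v' i| := abs_add_le _ _
      _ ≤ η + η := add_le_add (hu i) (hv i)
      _ = 2 * η := by ring
  have hMs : ∀ i, |u i + v i| ≤ 2 * M := fun i =>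
    (abs_add_le _ _).trans ((add_le_add (hMu i) (hMv i)).trans (by ring_nf; rfl))
  have hMs' : ∀ i, |u' i + v' i| ≤ 2 * M' := fun i =>
    (abs_add_le _ _).trans ((add_le_add (hMu' i) (hMv' i)).trans (by ring_nf; rfl))
  have h1 := abs_gammaStat_sub_le (u := fun i => u i + v i) (v := fun i => u' i + v' i) hsum hMs hMs' N K
  have h2 := abs_gammaStat_sub_le hu hMu hMu' N K
  have h3 := abs_gammaStat_sub_le hv hMv hMv' N K
  unfold gammaCross
  rw [← sub_div, abs_div, abs_two]
  rw [div_le_iff₀ (by norm_num : (0 : ℝ) < 2)]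
  have e : gammaStat (fun i => u i + v i) N K - gammaStat u N K - gammaStat v N K
      - (gammaStat (fun i => u' i + v' i) N K - gammaStat u' N K - gammaStat v' N K)
      = (gammaStat (fun i => u i + v i) N K - gammaStat (fun i => u' i + v' i) N K)
        - (gammaStat u N K - gammaStat u' N K) - (gammaStat v N K - gammaStat v' N K) := by ring
  rw [e]
  calc |gammaStat (fun i => u i + v i) N K - gammaStat (fun i => u' i + v' i) N K
        - (gammaStat u N K - gammaStat u' N K) - (gammaStat v N K - gammaStat v' N K)|
      ≤ |gammaStat (fun i => u i + v i) N K - gammaStat (fun i => u' i + v' i) N K|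
        + |gammaStat u N K - gammaStat u' N K| + |gammaStat v N K - gammaStat v' N K| := by
          refine (abs_sub _ _).trans (add_le_add (abs_sub _ _) le_rfl)
    _ ≤ (2 * K + 1) * (4 * (2 * η) * (2 * M + 2 * M')) + (2 * K + 1) * (4 * η * (M + M'))
        + (2 * K + 1) * (4 * η * (M + M')) := add_le_add (add_le_add h1 h2) h3
    _ = (2 * K + 1) * (12 * η * (M + M')) * 2 := by ring

end Perturbation

end Summit.Ventures.LatticeQCDFlow.Scoring

end
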